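import Literature.Analysis.FluidPDE.CheskidovLimitForce
import Literature.Analysis.FunctionSpaces.TorusLerayHelmholtz
import HarnessLib

/-!
# Cheskidov's periodisation, V: solenoidal parts of the drift forces

Analysis/FluidPDE support file for the §6 periodisation step of Cheskidov, arXiv:2311.04182
(2023), Thm. 1.3, continuing `CheskidovLimitForce`. The vendored target
`cheskidov_time_periodic_anomaly` asks for *divergence-free* forces, whereas the body force
`∂ₜv₂ + (v₂·∇)v₂ - νΔv₂` of the periodised drift is not solenoidal; its gradient part is moved
into the pressure by the smooth Leray–Helmholtz decomposition on `T²` (named fact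
`Torus.smooth_leray_helmholtz`, `TorusLerayHelmholtz.lean`, taken as a hypothesis `hH`). Given
`D : FamilyData` and `hH`:

* `FamilyData.wF D hH m`, `FamilyData.phiF D hH m` — jointly smooth solenoidal part and mean-zero
  potential of the body force of `v₂^m` (`body force = wF + ∇phiF`), with `wF` divergence free,
  mean zero, `1`-periodic;
* `FamilyData.wInf D hH t`, `FamilyData.phiInf D hH t` — the smooth solenoidal part and mean-zero
  potential of the limit force `Ginf(t)` (fixed-time form `Torus.smooth_helmholtz`), `wInf` `1`-periodic, continuous in time with values in `L²`
  (`L²`-contractivity of the solenoidal part), and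
  `sup_t ‖wF^m(t) - wInf(t)‖_{L²} → 0` (`FamilyData.tendsto_wF_sub_wInf`).

## References

* A. Cheskidov, arXiv:2311.04182 (2023), §6, p. 18; J. C. Robinson, J. L. Rodrigo, W. Sadowski,
  *The Three-Dimensional Navier–Stokes Equations* (CUP 2016), Thm. 2.6, Def. 2.8 (Leray
  projector).
-/

open MeasureTheory Set Filter Topology Function

noncomputable section

namespace Literature.Analysis.FluidPDE

namespace CheskidovPeriodic

/-- The flat two-torus (local notation). [folklore] -/
local notation "𝕋²" => UnitAddTorus (Fin 2)
/-- `ℝ²` (local notation). [folklore] -/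
local notation "E²" => EuclideanSpace ℝ (Fin 2)

namespace FamilyData

variable (D : FamilyData) (hH : FunctionSpaces.Torus.smooth_leray_helmholtz (Fin 2))

/-! ## The solenoidal part of the body force of the periodised drift -/

/-- The solenoidal part `wF^m` of the body force of `v₂^m` (Leray–Helmholtz, via `hH`). [cite: Cheskidov2023, §6 p. 18] -/
def wF (m : ℕ) : ℝ → 𝕋² → E² := Classical.choose (hH _ (D.nsBodyForce_v2_smooth m))

/-- The mean-zero potential `phiF^m` of the gradient part of the body force of `v₂^m`. [cite: Cheskidov2023, §6 p. 18] -/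
def phiF (m : ℕ) : ℝ → 𝕋² → ℝ :=
  Classical.choose (Classical.choose_spec (hH _ (D.nsBodyForce_v2_smooth m)))

/-- The defining properties of `(wF^m, phiF^m)`. [folklore] -/
theorem wF_spec (m : ℕ) :
    FunctionSpaces.Torus.IsSmoothSpaceTimeOn univ (D.wF hH m) ∧
      FunctionSpaces.Torus.IsSmoothSpaceTimeOn univ (D.phiF hH m) ∧
      (∀ t, FunctionSpaces.Torus.IsDivFree (D.wF hH m t)) ∧
      (∀ t, FunctionSpaces.Torus.HasZeroMean (D.phiF hH m t)) ∧
      ∀ t x, Torus.nsBodyForce (D.ν m) (D.v2 m) t x =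
        D.wF hH m t x + FunctionSpaces.Torus.gradient (D.phiF hH m t) x :=
  Classical.choose_spec (Classical.choose_spec (hH _ (D.nsBodyForce_v2_smooth m)))

/-- `wF^m` is jointly smooth. [folklore] -/
theorem wF_smooth (m : ℕ) : FunctionSpaces.Torus.IsSmoothSpaceTimeOn univ (D.wF hH m) := (D.wF_spec hH m).1

/-- `phiF^m` is jointly smooth. [folklore] -/
theorem phiF_smooth (m : ℕ) : FunctionSpaces.Torus.IsSmoothSpaceTimeOn univ (D.phiF hH m) := (D.wF_spec hH m).2.1

/-- `wF^m(t)` is divergence free. [folklore] -/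
theorem wF_divFree (m : ℕ) (t : ℝ) : FunctionSpaces.Torus.IsDivFree (D.wF hH m t) := (D.wF_spec hH m).2.2.1 t

/-- The decomposition `body force = wF + ∇phiF`. [folklore] -/
theorem nsBodyForce_v2_eq (m : ℕ) (t : ℝ) (x : 𝕋²) :
    Torus.nsBodyForce (D.ν m) (D.v2 m) t x =
      D.wF hH m t x + FunctionSpaces.Torus.gradient (D.phiF hH m t) x :=
  (D.wF_spec hH m).2.2.2.2 t x

/-- `wF^m(t)` has zero mean (the body force has, and gradients have). [folklore] -/
theorem wF_zeroMean (m : ℕ) (t : ℝ) : FunctionSpaces.Torus.HasZeroMean (D.wF hH m t) := by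
  have hw := (D.wF_smooth hH m).isSmooth_slice (mem_univ t)
  have hφ := (D.phiF_smooth hH m).isSmooth_slice (mem_univ t)
  refine (FunctionSpaces.Torus.hasZeroMean_add_gradient_iff hw hφ).1 ?_
  have h : (fun x => D.wF hH m t x + FunctionSpaces.Torus.gradient (D.phiF hH m t) x) =
      Torus.nsBodyForce (D.ν m) (D.v2 m) t := by
    funext x; exact (D.nsBodyForce_v2_eq hH m t x).symm
  rw [h]
  exact D.nsBodyForce_v2_zeroMean m t

/-- `wF^m` is `1`-periodic (uniqueness of the solenoidal part). [folklore] -/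
theorem wF_periodic (m : ℕ) : Periodic (D.wF hH m) 1 :=
  FunctionSpaces.Torus.periodic_of_helmholtz (D.nsBodyForce_v2_periodic m)
    (fun t => (D.wF_smooth hH m).isSmooth_slice (mem_univ t)) (D.wF_divFree hH m)
    (fun t => (D.phiF_smooth hH m).isSmooth_slice (mem_univ t)) (D.nsBodyForce_v2_eq hH m)

/-! ## The solenoidal part of the limit drift force -/

/-- The solenoidal part `wInf(t)` of the limit force `Ginf(t)` (fixed-time Leray–Helmholtz). [cite: Cheskidov2023, §6 p. 18] -/
def wInf (t : ℝ) : 𝕋² → E² := Classical.choose (hH.smooth_helmholtz _ (D.Ginf_smooth_slice t))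

/-- The mean-zero potential of the gradient part of `Ginf(t)`. [cite: Cheskidov2023, §6 p. 18] -/
def phiInf (t : ℝ) : 𝕋² → ℝ :=
  Classical.choose (Classical.choose_spec (hH.smooth_helmholtz _ (D.Ginf_smooth_slice t)))

/-- The defining properties of `(wInf(t), phiInf(t))`. [folklore] -/
theorem wInf_spec (t : ℝ) :
    FunctionSpaces.Torus.IsSmooth (D.wInf hH t) ∧ FunctionSpaces.Torus.IsSmooth (D.phiInf hH t) ∧
      FunctionSpaces.Torus.IsDivFree (D.wInf hH t) ∧ FunctionSpaces.Torus.HasZeroMean (D.phiInf hH t) ∧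
      ∀ x, D.Ginf t x = D.wInf hH t x + FunctionSpaces.Torus.gradient (D.phiInf hH t) x :=
  Classical.choose_spec (Classical.choose_spec (hH.smooth_helmholtz _ (D.Ginf_smooth_slice t)))

/-- `wInf` is `1`-periodic. [folklore] -/
theorem wInf_periodic : Periodic (D.wInf hH) 1 :=
  FunctionSpaces.Torus.periodic_of_helmholtz D.Ginf_periodic (fun t => (D.wInf_spec hH t).1)
    (fun t => (D.wInf_spec hH t).2.2.1) (fun t => (D.wInf_spec hH t).2.1) (fun t => (D.wInf_spec hH t).2.2.2.2)

/-- **`L²`-contractivity between the two solenoidal parts**: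
`‖wF^m(t) - wInf(t)‖_{L²} ≤ ‖(body force of v₂^m)(t) - Ginf(t)‖_{L²}`. [folklore] -/
theorem eLpNorm_wF_sub_wInf_le (m : ℕ) (t : ℝ) :
    eLpNorm (D.wF hH m t - D.wInf hH t) 2 volume ≤
      eLpNorm (Torus.nsBodyForce (D.ν m) (D.v2 m) t - D.Ginf t) 2 volume :=
  FunctionSpaces.Torus.eLpNorm_sub_le_of_helmholtz ((D.wF_smooth hH m).isSmooth_slice (mem_univ t))
    (D.wInf_spec hH t).1 (D.wF_divFree hH m t) (D.wInf_spec hH t).2.2.1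
    ((D.phiF_smooth hH m).isSmooth_slice (mem_univ t)) (D.wInf_spec hH t).2.1
    (D.nsBodyForce_v2_eq hH m t) (D.wInf_spec hH t).2.2.2.2

/-- **`wInf ∈ C(ℝ; L²)`** (contractivity against `Ginf ∈ C(ℝ; L²)`). [cite: Cheskidov2023, §6 p. 18] -/
theorem wInf_continuousInLpOn : Torus.ContinuousInLpOn univ 2 (D.wInf hH) := by
  refine ⟨fun t _ => (D.wInf_spec hH t).1.memLp 2, fun t₀ _ => ?_⟩
  have h := D.Ginf_continuousInLpOn.2 t₀ (mem_univ t₀)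
  refine tendsto_of_tendsto_of_tendsto_of_le_of_le' tendsto_const_nhds h
    (Eventually.of_forall fun t => zero_le) (Eventually.of_forall fun t => ?_)
  exact FunctionSpaces.Torus.eLpNorm_sub_le_of_helmholtz (D.wInf_spec hH t).1 (D.wInf_spec hH t₀).1
    (D.wInf_spec hH t).2.2.1 (D.wInf_spec hH t₀).2.2.1 (D.wInf_spec hH t).2.1 (D.wInf_spec hH t₀).2.1
    (D.wInf_spec hH t).2.2.2.2 (D.wInf_spec hH t₀).2.2.2.2

/-- **Convergence of the solenoidal parts**: `sup_t ‖wF^m(t) - wInf(t)‖_{L²} → 0`. [cite: Cheskidov2023, §6 p. 18] -/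
theorem tendsto_wF_sub_wInf :
    Tendsto (fun m => ⨆ t : ℝ, eLpNorm (D.wF hH m t - D.wInf hH t) 2 volume) atTop (𝓝 0) :=
  tendsto_of_tendsto_of_tendsto_of_le_of_le' tendsto_const_nhds D.tendsto_nsBodyForce_v2_sub_Ginf
    (Eventually.of_forall fun _ => zero_le)
    (Eventually.of_forall fun m => iSup_mono fun t => D.eLpNorm_wF_sub_wInf_le hH m t)

end FamilyData

end CheskidovPeriodic

end Literature.Analysis.FluidPDE

end
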